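import Summits.BirchSwinnertonDyer.Rank1Residual.X2.KellerYinFreePartGap
import HarnessLib

/-!
# The KEY-CONGRUENCE step of Castella–Grossi–Skinner §6 in the kernel: congruent power series
# have the same Iwasawa invariants, ideal congruences are unit congruences, and the SINGLE-LEVEL
# transfer of a main conjecture along a congruence (cell `bsd-eis`, seat `bsd-eis-cgshw` g16;
# route `EisensteinPrimes`, crux 3 `MazurMCOnCellB` ∩ non-split / crux 4's partner atom; memo
# `HOME/cgshw-MEMO-20.md` §1–§2)

HONEST FRAMING (cell `bsd-eis`, run/shared/lean/pub/bsd-eis/): pure commutative algebra of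
`Λ = ℤ_p⟦T⟧`, everything PROVED (Mathlib + the tree's `X1.MuLambda` API); nothing booked; X2 stays
CONSTRUCTION-SHAPED; no label or count moves; BSD is proved for no curve by this file.

## The point

Castella–Grossi–Skinner, *Mazur's main conjecture at Eisenstein primes* (Math. Ann. 2025 =
arXiv:2303.04373), proof of Thm. 7.2.3 (= Thm. 6.1.3 of the arXiv version; eq. `key-cong`): "Taking `m ≫ 0`, it follows from the
congruence `𝓕 ≡ 𝓕(α) ≡ 𝓛(α) ≡ 𝓛 (mod ϖ^m)` that `𝓕` and `𝓛` have the same Iwasawa invariants `λ`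
and `μ`, and so equality holds [in the divisibility]". The same step closes the HIDA-LIMIT transfer
of Skinner 2016 §3.1 / Keller–Yin §5 at ONE sufficiently deep level instead of at all levels: if
the target pair `(g_E, L_E)` (characteristic series, `p`-adic `L`-function) satisfies ONE
divisibility `g_E ∣ L_E` (Kato–Wuthrich) and is congruent modulo `p^m`, `m > μ(L_E)`, to a pair
`(g_N, L_N)` for which the main conjecture `(g_N) = (L_N)` holds, then `(g_E) = (L_E)`.

## Contents (all over `Λ = IwasawaAlgebra p = ℤ_[p]⟦T⟧`, `mu`/`lam`/`pfree`/`red` of `X1.MuLambda`)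

* §1 `ne_zero_and_mu_eq_and_lam_eq_of_sub_mem_span_C_pow` — **KEY CONGRUENCE**: `g ≠ 0`,
  `μ(g) < m`, `g' ≡ g (mod p^m)` ⟹ `g' ≠ 0`, `μ(g') = μ(g)`, `λ(g') = λ(g)`; unit-multiple and
  `IsUnit`-invariance companions (`mu_mul_of_isUnit`, `lam_mul_of_isUnit`).
* §2 `exists_isUnit_and_sub_mul_mem_of_span_sup_eq` — **IDEAL CONGRUENCE ⟹ UNIT CONGRUENCE**:
  `(a) + (p)^m = (b) + (p)^m` with `μ(a) < m` ⟹ `b ≡ a·u (mod p^m)` for a unit `u` (so the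
  Fitting/`L`-function congruences of the transfer, which are congruences of IDEALS, feed §1).
* §3 `dvd_of_dvd_C_pow_mul_of_mu_le` — **a rational divisibility with the right `μ`-inequality is
  integral**: `L ∣ p^t·g`, `μ(L) ≤ μ(g)` ⟹ `L ∣ g` (the `μ`-general form of the tree's
  `KellerYinFreePartGap.dvd_of_dvd_C_pow_mul_of_mu_eq_zero`).
* §4 `span_eq_span_of_singleLevel_congruences` — **THE SINGLE-LEVEL TRANSFER** (ring form):
  `L_E ≠ 0`, `g_E ∣ L_E`, `μ(L_E) < m`, `(g_E) + (p)^m = (g_N) + (p)^m`, `(L_E) + (p)^m =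
  (L_N) + (p)^m`, `(g_N) = (L_N)` ⟹ `(g_E) = (L_E)`; and the invariants form
  `mu_eq_and_lam_eq_of_singleLevel_congruences`.
* §5 `span_eq_span_of_anchor_congruences` — **ANCHOR ⟹ MEMBER**: `(g₂) = (L₂)` known exactly,
  congruences at a level `m > μ(L₂)`, and a RATIONAL divisibility `g ∣ p^t·L` at the congruent pair
  ⟹ `(g) = (L)` (memo §3 Claim B: Mazur's main conjecture for the members of a Hida family near an
  anchored weight-2 point).

What this is NOT: not a statement about Selmer groups (the module form, with Greenberg's
Prop. 4.15 (ii) and Kato–Wuthrich as the published inputs, is `X2/HidaLimitSingleLevel.lean`); not a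
proof of any main conjecture; the congruent pair `(g_N, L_N)` with its main conjecture is an INPUT.

References: [CastellaGrossiSkinner2025] proof of Thm. 7.2.3 (Math. Ann. 393; = arXiv §6.1 Thm. 6.1.3, eq. (key-cong));
[Skinner2016PacificMC] §3.1 p. 192; [KellerYin2024] §5 (a)–(e), Lemma 5.1.2 (PRE, shape only);
[GreenbergVatsal2000] p. 4 (closing by invariants); [Washington1997] §7.1, §13.1.
-/

set_option autoImplicit false

noncomputable section

open Literature.NumberTheory.EllipticCurves Summit.BirchSwinnertonDyer.Rank1Residual.X1.MuLambda

namespace Summit.BirchSwinnertonDyer.Rank1Residual.X2.KeyCongruence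

variable {p : ℕ} [Fact p.Prime]

/-! ## §1. Congruent power series have the same Iwasawa invariants -/

/-- `red (C (p ^ n) * h) = 0` for `n ≥ 1`: a multiple of `p` reduces to `0` mod `p`. [folklore] -/
theorem red_C_pow_mul_eq_zero {n : ℕ} (hn : 1 ≤ n) (h : IwasawaAlgebra p) :
    red (PowerSeries.C ((p : ℤ_[p]) ^ n) * h) = 0 := by
  rw [red_eq_zero_iff]
  obtain ⟨d, rfl⟩ := Nat.exists_eq_add_of_le hn
  exact ⟨PowerSeries.C ((p : ℤ_[p]) ^ d) * h, by rw [pow_add, pow_one, map_mul]; ring⟩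

/-- **KEY CONGRUENCE (Castella–Grossi–Skinner, proof of Thm. 7.2.3 = arXiv Thm. 6.1.3, eq. (key-cong)).** Over
`Λ = ℤ_p⟦T⟧`: if `g ≠ 0`, `μ(g) < m` and `g' = g + p^m·h`, then `g' ≠ 0`, `μ(g') = μ(g)` and
`λ(g') = λ(g)`. Proof: `g = p^{μ}·g₀` with `g₀ ≢ 0 (mod p)`, so `g' = p^{μ}·(g₀ + p^{m−μ} h)` and
`g₀ + p^{m−μ}h ≡ g₀ (mod p)` has the same reduction, hence the same order of vanishing.
[cite: CastellaGrossiSkinner2025, proof of Thm. 7.2.3 (= arXiv Thm. 6.1.3; eq. key-cong)] [cite: Washington1997, §7.1] -/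
theorem ne_zero_and_mu_eq_and_lam_eq_of_eq_add_C_pow_mul {g g' h : IwasawaAlgebra p} (hg : g ≠ 0)
    {m : ℕ} (hm : mu g < m) (hgh : g' = g + PowerSeries.C ((p : ℤ_[p]) ^ m) * h) :
    g' ≠ 0 ∧ mu g' = mu g ∧ lam g' = lam g := by
  obtain ⟨d, hd⟩ := Nat.exists_eq_add_of_lt hm
  -- `m = μ + (d + 1)`
  set μ := mu g with hμ
  set g₀ := pfree g with hg₀
  have hred₀ : red g₀ ≠ 0 := red_pfree_ne_zero hg
  set G₀ : IwasawaAlgebra p := g₀ + PowerSeries.C ((p : ℤ_[p]) ^ (d + 1)) * h with hG₀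
  have hredG : red G₀ = red g₀ := by
    have h0 := red_C_pow_mul_eq_zero (p := p) (Nat.succ_le_succ (Nat.zero_le d)) h
    simp only [red] at h0 ⊢
    rw [hG₀, map_add, h0, add_zero]
  have hredG₀ : red G₀ ≠ 0 := by rw [hredG]; exact hred₀
  have hdec : g' = PowerSeries.C ((p : ℤ_[p]) ^ μ) * G₀ := by
    rw [hgh, hG₀, hd, mul_add, ← mul_assoc, ← map_mul, ← pow_add]
    congr 1
    exact eq_C_pow_mu_mul_pfree g
  obtain ⟨hmu', hpf'⟩ := mu_eq_and_pfree_eq hredG₀ hdec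
  have hG₀ne : G₀ ≠ 0 := by
    intro h0
    exact hredG₀ (by rw [h0]; simp [red])
  refine ⟨?_, hmu', ?_⟩
  · rw [hdec]
    exact mul_ne_zero (C_pow_ne_zero μ) hG₀ne
  · rw [lam, lam, hpf', hredG]

/-- Key congruence, membership form: `g ≠ 0`, `μ(g) < m`, `g' − g ∈ (p^m)` ⟹ `g' ≠ 0`,
`μ(g') = μ(g)`, `λ(g') = λ(g)`. [cite: CastellaGrossiSkinner2025, proof of Thm. 7.2.3 (= arXiv Thm. 6.1.3; eq. key-cong)] -/
theorem ne_zero_and_mu_eq_and_lam_eq_of_sub_mem_span_C_pow {g g' : IwasawaAlgebra p} (hg : g ≠ 0)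
    {m : ℕ} (hm : mu g < m)
    (h : g' - g ∈ Ideal.span ({PowerSeries.C ((p : ℤ_[p]) ^ m)} : Set (IwasawaAlgebra p))) :
    g' ≠ 0 ∧ mu g' = mu g ∧ lam g' = lam g := by
  obtain ⟨k, hk⟩ := Ideal.mem_span_singleton'.mp h
  exact ne_zero_and_mu_eq_and_lam_eq_of_eq_add_C_pow_mul hg hm (h := k)
    (sub_eq_iff_eq_add'.mp (by rw [← hk, mul_comm]))

/-- A unit of `Λ` is nonzero with `μ = λ = 0` (restatement of the tree's characterisation).
[cite: Washington1997, §7.1] -/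
theorem ne_zero_and_mu_eq_zero_and_lam_eq_zero_of_isUnit {u : IwasawaAlgebra p} (hu : IsUnit u) :
    u ≠ 0 ∧ mu u = 0 ∧ lam u = 0 :=
  (isUnit_iff_mu_eq_zero_and_lam_eq_zero u).mp hu

/-- `μ(g·u) = μ(g)` for a unit `u`. [folklore] -/
theorem mu_mul_of_isUnit {g u : IwasawaAlgebra p} (hg : g ≠ 0) (hu : IsUnit u) :
    mu (g * u) = mu g := by
  obtain ⟨hu0, hμ, -⟩ := ne_zero_and_mu_eq_zero_and_lam_eq_zero_of_isUnit hu
  rw [mu_mul hg hu0, hμ, add_zero]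

/-- `λ(g·u) = λ(g)` for a unit `u`. [folklore] -/
theorem lam_mul_of_isUnit {g u : IwasawaAlgebra p} (hg : g ≠ 0) (hu : IsUnit u) :
    lam (g * u) = lam g := by
  obtain ⟨hu0, -, hl⟩ := ne_zero_and_mu_eq_zero_and_lam_eq_zero_of_isUnit hu
  rw [lam_mul hg hu0, hl, add_zero]

/-- Key congruence up to a unit: `g ≠ 0`, `μ(g) < m`, `u` a unit, `g' − g·u ∈ (p^m)` ⟹ `g' ≠ 0`,
`μ(g') = μ(g)`, `λ(g') = λ(g)`. [cite: CastellaGrossiSkinner2025, proof of Thm. 7.2.3 (= arXiv Thm. 6.1.3; eq. key-cong)] -/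
theorem ne_zero_and_mu_eq_and_lam_eq_of_sub_mul_unit_mem_span_C_pow {g g' u : IwasawaAlgebra p}
    (hg : g ≠ 0) (hu : IsUnit u) {m : ℕ} (hm : mu g < m)
    (h : g' - g * u ∈ Ideal.span ({PowerSeries.C ((p : ℤ_[p]) ^ m)} : Set (IwasawaAlgebra p))) :
    g' ≠ 0 ∧ mu g' = mu g ∧ lam g' = lam g := by
  have hgu : g * u ≠ 0 := mul_ne_zero hg hu.ne_zero
  have hm' : mu (g * u) < m := by rwa [mu_mul_of_isUnit hg hu]
  obtain ⟨h0, hμ, hl⟩ := ne_zero_and_mu_eq_and_lam_eq_of_sub_mem_span_C_pow hgu hm' h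
  exact ⟨h0, hμ.trans (mu_mul_of_isUnit hg hu), hl.trans (lam_mul_of_isUnit hg hu)⟩

/-! ## §2. Ideal congruences are unit congruences -/

/-- `(p)^m = (p^m)` as ideals of `Λ`. [folklore] -/
theorem span_C_p_pow_eq (m : ℕ) :
    (Ideal.span ({PowerSeries.C (p : ℤ_[p])} : Set (IwasawaAlgebra p))) ^ m =
      Ideal.span {PowerSeries.C ((p : ℤ_[p]) ^ m)} := by
  rw [Ideal.span_singleton_pow, C_pow_eq]

/-- If `p ∣ c` in `Λ` then `1 − c` is a unit (`Λ` is local and `p` is a non-unit). [folklore] -/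
theorem isUnit_one_sub_of_C_p_dvd {c : IwasawaAlgebra p} (hc : PowerSeries.C (p : ℤ_[p]) ∣ c) :
    IsUnit (1 - c) := by
  apply IsLocalRing.isUnit_one_sub_self_of_mem_nonunits
  obtain ⟨c', rfl⟩ := hc
  rw [mem_nonunits_iff]
  intro hunit
  exact (IwasawaAlgebra.prime_C p).not_unit (isUnit_of_mul_isUnit_left hunit)

/-- **IDEAL CONGRUENCE ⟹ UNIT CONGRUENCE.** Over `Λ = ℤ_p⟦T⟧`: if `a ≠ 0`, `μ(a) < m` and
`(a) + (p)^m = (b) + (p)^m`, then `b ≡ a·u (mod p^m)` for some unit `u`. Proof: `b = r a + p^m s`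
and `a = r' b + p^m s'` give `a(1 − r'r) ∈ (p^m)`; since `μ(a) < m`, `p ∣ 1 − r'r`, so `r'r`, hence
`r`, is a unit. (This is why the congruences of IDEALS delivered by Fitting ideals and by two-variable
`p`-adic `L`-functions feed the key congruence of §1.) [cite: Skinner2016PacificMC, §3.1 (p. 192)]
[cite: Washington1997, §7.1] -/
theorem exists_isUnit_and_sub_mul_mem_of_span_sup_eq {a b : IwasawaAlgebra p} (ha : a ≠ 0)
    {m : ℕ} (hm : mu a < m)
    (h : Ideal.span {a} ⊔ (Ideal.span {PowerSeries.C (p : ℤ_[p])}) ^ m =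
      Ideal.span {b} ⊔ (Ideal.span {PowerSeries.C (p : ℤ_[p])}) ^ m) :
    ∃ u : IwasawaAlgebra p, IsUnit u ∧
      b - a * u ∈ Ideal.span ({PowerSeries.C ((p : ℤ_[p]) ^ m)} : Set (IwasawaAlgebra p)) := by
  rw [span_C_p_pow_eq] at h
  set P : IwasawaAlgebra p := PowerSeries.C ((p : ℤ_[p]) ^ m) with hP
  -- `b = r a + P s`
  have hb : b ∈ Ideal.span {a} ⊔ Ideal.span {P} := by
    rw [h]; exact Ideal.mem_sup_left (Ideal.mem_span_singleton_self b)
  obtain ⟨r, y, hy, hry⟩ := Ideal.mem_span_singleton_sup.mp hb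
  obtain ⟨s, rfl⟩ := Ideal.mem_span_singleton'.mp hy
  -- `a = r' b + P s'`
  have ha' : a ∈ Ideal.span {b} ⊔ Ideal.span {P} := by
    rw [← h]; exact Ideal.mem_sup_left (Ideal.mem_span_singleton_self a)
  obtain ⟨r', y', hy', hry'⟩ := Ideal.mem_span_singleton_sup.mp ha'
  obtain ⟨s', rfl⟩ := Ideal.mem_span_singleton'.mp hy'
  -- `a (1 - r' r) = P (r' s + s')`
  have hkey : a * (1 - r' * r) = P * (r' * s + s') := by
    have e1 : r * a + s * P = b := hry
    have e2 : r' * b + s' * P = a := hry'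
    rw [← e1] at e2
    linear_combination (-1 : IwasawaAlgebra p) * e2
  -- `r` is a unit
  have hru : IsUnit r := by
    by_cases hc : (1 - r' * r) = 0
    · have : r' * r = 1 := by linear_combination -hc
      exact IsUnit.of_mul_eq_one_right r' this
    · have hne : a * (1 - r' * r) ≠ 0 := mul_ne_zero ha hc
      have hdvd : PowerSeries.C ((p : ℤ_[p]) ^ m) ∣ a * (1 - r' * r) := ⟨r' * s + s', hkey⟩
      have hle : m ≤ mu (a * (1 - r' * r)) := le_mu_of_C_pow_dvd hne hdvd
      rw [mu_mul ha hc] at hle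
      have hμc : 1 ≤ mu (1 - r' * r) := by omega
      have hpc : PowerSeries.C (p : ℤ_[p]) ∣ (1 - r' * r) := by
        have h1 := C_pow_mu_dvd (p := p) hc
        rw [C_pow_eq] at h1
        exact (dvd_pow_self _ (by omega : mu (1 - r' * r) ≠ 0)).trans h1
      have hunit : IsUnit (1 - (1 - r' * r)) := isUnit_one_sub_of_C_p_dvd hpc
      rw [sub_sub_cancel] at hunit
      exact isUnit_of_mul_isUnit_right hunit
  refine ⟨r, hru, Ideal.mem_span_singleton'.mpr ⟨s, ?_⟩⟩
  linear_combination hry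

/-- **Ideal congruence ⟹ equal invariants.** If `a ≠ 0`, `μ(a) < m` and
`(a) + (p)^m = (b) + (p)^m` then `b ≠ 0`, `μ(b) = μ(a)`, `λ(b) = λ(a)`.
[cite: CastellaGrossiSkinner2025, proof of Thm. 7.2.3 (= arXiv Thm. 6.1.3; eq. key-cong)] -/
theorem ne_zero_and_mu_eq_and_lam_eq_of_span_sup_eq {a b : IwasawaAlgebra p} (ha : a ≠ 0)
    {m : ℕ} (hm : mu a < m)
    (h : Ideal.span {a} ⊔ (Ideal.span {PowerSeries.C (p : ℤ_[p])}) ^ m =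
      Ideal.span {b} ⊔ (Ideal.span {PowerSeries.C (p : ℤ_[p])}) ^ m) :
    b ≠ 0 ∧ mu b = mu a ∧ lam b = lam a := by
  obtain ⟨u, hu, hbu⟩ := exists_isUnit_and_sub_mul_mem_of_span_sup_eq ha hm h
  exact ne_zero_and_mu_eq_and_lam_eq_of_sub_mul_unit_mem_span_C_pow ha hu hm hbu

/-! ## §3. A rational divisibility with the right `μ`-inequality is integral -/

/-- **Peeling off `p` under a `μ`-inequality.** If `g ≠ 0`, `L ∣ p^t·g` and `μ(L) ≤ μ(g)` in
`Λ = ℤ_p⟦T⟧`, then `L ∣ g`: writing `p^t g = L h` and comparing `μ`, `μ(h) ≥ t`, so `p^t ∣ h`.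
(For `μ(L) = 0` this is the tree's `KellerYinFreePartGap.dvd_of_dvd_C_pow_mul_of_mu_eq_zero`.)
[cite: GreenbergVatsal2000, p. 4 (after Thm. (1.2))] [cite: Washington1997, §7.1] -/
theorem dvd_of_dvd_C_pow_mul_of_mu_le {L g : IwasawaAlgebra p} (hg : g ≠ 0) (t : ℕ)
    (h : L ∣ PowerSeries.C (p : ℤ_[p]) ^ t * g) (hμ : mu L ≤ mu g) : L ∣ g := by
  obtain ⟨k, hk⟩ := h
  have hPg : PowerSeries.C (p : ℤ_[p]) ^ t * g ≠ 0 :=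
    mul_ne_zero (pow_ne_zero _ (IwasawaAlgebra.prime_C p).ne_zero) hg
  have hL : L ≠ 0 := by rintro rfl; exact hPg (by rw [hk, zero_mul])
  have hk0 : k ≠ 0 := by rintro rfl; exact hPg (by rw [hk, mul_zero])
  -- compare `μ`: `t + μ(g) = μ(L) + μ(k)`
  have hμeq : t + mu g = mu L + mu k := by
    have h1 : mu (PowerSeries.C (p : ℤ_[p]) ^ t * g) = t + mu g := by
      rw [← C_pow_eq, mu_mul (C_pow_ne_zero t) hg,
        (mu_eq_and_pfree_eq (p := p) (g := PowerSeries.C ((p : ℤ_[p]) ^ t)) (g₀ := 1) (a := t)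
          (by simp [red]) (by simp)).1]
    rw [← h1, hk, mu_mul hL hk0]
  have hμk : t ≤ mu k := by omega
  -- so `p^t ∣ k`
  have hdvd : PowerSeries.C (p : ℤ_[p]) ^ t ∣ k := by
    have h1 := C_pow_mu_dvd (p := p) hk0
    rw [C_pow_eq] at h1
    exact (pow_dvd_pow _ hμk).trans h1
  obtain ⟨k', rfl⟩ := hdvd
  refine ⟨k', mul_left_cancel₀ (pow_ne_zero t (IwasawaAlgebra.prime_C p).ne_zero) ?_⟩
  rw [hk]; ring

/-! ## §4. The single-level transfer -/

/-- **THE SINGLE-LEVEL TRANSFER, ring form.** Over `Λ = ℤ_p⟦T⟧` let `g_E ∣ L_E ≠ 0` (one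
divisibility at the target: Kato–Wuthrich), `m > μ(L_E)`, and let `(g_N, L_N)` be a pair with
`(g_E) + (p)^m = (g_N) + (p)^m` (Selmer/Fitting congruence), `(L_E) + (p)^m = (L_N) + (p)^m`
(`L`-function congruence) and `(g_N) = (L_N)` (the main conjecture for the congruent object). Then
`μ(g_E) = μ(L_E)` and `λ(g_E) = λ(L_E)`. Proof: `μ(g_E) ≤ μ(L_E) < m`, so §2 transports the
invariants of `g_E`, `L_E` to `g_N`, `L_N`, which agree since `(g_N) = (L_N)`.
[cite: CastellaGrossiSkinner2025, proof of Thm. 7.2.3 (= arXiv Thm. 6.1.3; eq. key-cong)] [cite: Skinner2016PacificMC, §3.1 (p. 192)] -/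
theorem mu_eq_and_lam_eq_of_singleLevel_congruences {gE LE gN LN : IwasawaAlgebra p}
    (hLE : LE ≠ 0) (hdvd : gE ∣ LE) {m : ℕ} (hm : mu LE < m)
    (hS : Ideal.span {gE} ⊔ (Ideal.span {PowerSeries.C (p : ℤ_[p])}) ^ m =
      Ideal.span {gN} ⊔ (Ideal.span {PowerSeries.C (p : ℤ_[p])}) ^ m)
    (hL : Ideal.span {LE} ⊔ (Ideal.span {PowerSeries.C (p : ℤ_[p])}) ^ m =
      Ideal.span {LN} ⊔ (Ideal.span {PowerSeries.C (p : ℤ_[p])}) ^ m)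
    (hN : Ideal.span ({gN} : Set (IwasawaAlgebra p)) = Ideal.span {LN}) :
    mu gE = mu LE ∧ lam gE = lam LE := by
  obtain ⟨h, hfac⟩ := hdvd
  have hgE : gE ≠ 0 := by rintro rfl; exact hLE (by rw [hfac, zero_mul])
  have hh : h ≠ 0 := by rintro rfl; exact hLE (by rw [hfac, mul_zero])
  have hμgE : mu gE < m := lt_of_le_of_lt (by rw [hfac]; exact mu_le_mu_mul hgE hh) hm
  -- transport invariants along the two congruences
  obtain ⟨hgN, hμgN, hlgN⟩ := ne_zero_and_mu_eq_and_lam_eq_of_span_sup_eq hgE hμgE hS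
  obtain ⟨hLN, hμLN, hlLN⟩ := ne_zero_and_mu_eq_and_lam_eq_of_span_sup_eq hLE hm hL
  -- `(g_N) = (L_N)`: associated, hence equal invariants
  obtain ⟨u, hu⟩ := Ideal.span_singleton_eq_span_singleton.mp hN
  have hLN' : LN = gN * ↑u := hu.symm
  have hμ : mu LN = mu gN := by rw [hLN', mu_mul_of_isUnit hgN u.isUnit]
  have hl : lam LN = lam gN := by rw [hLN', lam_mul_of_isUnit hgN u.isUnit]
  exact ⟨by rw [← hμgN, ← hμ, hμLN], by rw [← hlgN, ← hl, hlLN]⟩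

/-- **THE SINGLE-LEVEL TRANSFER, ideal form**: under the hypotheses of
`mu_eq_and_lam_eq_of_singleLevel_congruences`, `(g_E) = (L_E)` — one divisibility plus equal
invariants is equality of ideals (`X1.MuLambda.span_eq_span_iff_mu_lam`). This is the Hida-limit
transfer of Skinner 2016 §3.1 / Keller–Yin §5 closed at ONE level `m > μ(L_E)` (instead of by the
Krull intersection over all levels, `X11b.CongruenceLimit.iwasawaAlgebra_isTorsion_and_charIdeal_eq_of_congruences`).
[cite: Skinner2016PacificMC, §3.1 (p. 192)] [cite: GreenbergVatsal2000, p. 4 (after Thm. (1.2))] -/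
theorem span_eq_span_of_singleLevel_congruences {gE LE gN LN : IwasawaAlgebra p}
    (hLE : LE ≠ 0) (hdvd : gE ∣ LE) {m : ℕ} (hm : mu LE < m)
    (hS : Ideal.span {gE} ⊔ (Ideal.span {PowerSeries.C (p : ℤ_[p])}) ^ m =
      Ideal.span {gN} ⊔ (Ideal.span {PowerSeries.C (p : ℤ_[p])}) ^ m)
    (hL : Ideal.span {LE} ⊔ (Ideal.span {PowerSeries.C (p : ℤ_[p])}) ^ m =
      Ideal.span {LN} ⊔ (Ideal.span {PowerSeries.C (p : ℤ_[p])}) ^ m)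
    (hN : Ideal.span ({gN} : Set (IwasawaAlgebra p)) = Ideal.span {LN}) :
    Ideal.span ({gE} : Set (IwasawaAlgebra p)) = Ideal.span {LE} := by
  obtain ⟨hμ, hl⟩ := mu_eq_and_lam_eq_of_singleLevel_congruences hLE hdvd hm hS hL hN
  obtain ⟨h, hfac⟩ := hdvd
  have hgE : gE ≠ 0 := by rintro rfl; exact hLE (by rw [hfac, zero_mul])
  exact ((span_eq_span_iff_mu_lam hgE hLE hfac).mpr ⟨hμ.symm, hl.symm⟩).symm

/-! ## §5. From an anchored point to a congruent one (memo §3, Claim B — the algebra) -/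

/-- **ANCHOR ⟹ MEMBER.** Over `Λ = ℤ_p⟦T⟧` let `(g₂, L₂)` be an ANCHORED pair — `L₂ ≠ 0` and
`(g₂) = (L₂)` (a main conjecture known exactly, e.g. Castella–Grossi–Skinner Thm. A at a weight-2
point) — and `(g, L)` a pair congruent to it at a level `m > μ(L₂)`: `(g₂) + (p)^m = (g) + (p)^m`,
`(L₂) + (p)^m = (L) + (p)^m`. If `g ∣ p^t·L` for some `t` (a RATIONAL divisibility at the member:
Kato's theorem with `p` inverted), then `(g) = (L)` — exactly, `μ` included. Proof: §2 transports the
invariants (`μ(g) = μ(g₂) = μ(L₂) = μ(L)`, same for `λ`), §3 makes the divisibility integral, and one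
divisibility plus equal invariants is equality. [cite: CastellaGrossiSkinner2025, proof of Thm. 7.2.3 (= arXiv Thm. 6.1.3; eq. key-cong)]
[cite: GreenbergVatsal2000, p. 4 (after Thm. (1.2))] -/
theorem span_eq_span_of_anchor_congruences {g₂ L₂ g L : IwasawaAlgebra p} (hL₂ : L₂ ≠ 0)
    (hanchor : Ideal.span ({g₂} : Set (IwasawaAlgebra p)) = Ideal.span {L₂}) {m : ℕ}
    (hm : mu L₂ < m)
    (hS : Ideal.span {g₂} ⊔ (Ideal.span {PowerSeries.C (p : ℤ_[p])}) ^ m =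
      Ideal.span {g} ⊔ (Ideal.span {PowerSeries.C (p : ℤ_[p])}) ^ m)
    (hLc : Ideal.span {L₂} ⊔ (Ideal.span {PowerSeries.C (p : ℤ_[p])}) ^ m =
      Ideal.span {L} ⊔ (Ideal.span {PowerSeries.C (p : ℤ_[p])}) ^ m)
    (t : ℕ) (hdvd : g ∣ PowerSeries.C (p : ℤ_[p]) ^ t * L) :
    Ideal.span ({g} : Set (IwasawaAlgebra p)) = Ideal.span {L} := by
  -- the anchor: `g₂`, `L₂` associated, hence `g₂ ≠ 0` with the invariants of `L₂`
  obtain ⟨u, hu⟩ := Ideal.span_singleton_eq_span_singleton.mp hanchor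
  have hL₂' : L₂ = g₂ * ↑u := hu.symm
  have hg₂ : g₂ ≠ 0 := by rintro rfl; exact hL₂ (by rw [hL₂', zero_mul])
  have hμ₂ : mu L₂ = mu g₂ := by rw [hL₂', mu_mul_of_isUnit hg₂ u.isUnit]
  have hl₂ : lam L₂ = lam g₂ := by rw [hL₂', lam_mul_of_isUnit hg₂ u.isUnit]
  have hmg : mu g₂ < m := by rwa [← hμ₂]
  -- transport along the two congruences
  obtain ⟨hg, hμg, hlg⟩ := ne_zero_and_mu_eq_and_lam_eq_of_span_sup_eq hg₂ hmg hS
  obtain ⟨hL, hμL, hlL⟩ := ne_zero_and_mu_eq_and_lam_eq_of_span_sup_eq hL₂ hm hLc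
  have hμ : mu g = mu L := by rw [hμg, ← hμ₂, hμL]
  have hl : lam g = lam L := by rw [hlg, ← hl₂, hlL]
  -- the rational divisibility is integral, then close by invariants
  obtain ⟨h, hfac⟩ := dvd_of_dvd_C_pow_mul_of_mu_le hL t hdvd hμ.le
  exact ((span_eq_span_iff_mu_lam hg hL hfac).mpr ⟨hμ.symm, hl.symm⟩).symm

end Summit.BirchSwinnertonDyer.Rank1Residual.X2.KeyCongruence

end
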